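import Summits.QuantumFields.YangMills.Theorems.UnitScaleTiltProp7NumericWindowsInhabited
import HarnessLib

/-!
# Route `UnitScaleTilt`, crux K1 child «MinimiserStabilityRegPr» (stmt-QuantumFields-19200), stub `stub_existenceMinimalOrbit` (EX), route (α) — **«NUMERICS-CENSUS» v2: THE NUMERIC ROWS OF THE EX
# DISPLAY OF RECORD S16ᴰ (✓p685936) ARE JOINTLY INHABITED** — all nineteen L-only windows `hWQ hWe hWε hMe hw137 hq47 hR6 hrε2 hεC hdomC hselfC hcontrC hrα hr4 hr16 hqΘ hR16 hC4 hMdoor` (+ S18's `hwinC` of ★px21 ✓p687965) together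
# with the positivity binders `hC₄ ha₃ hα hr hM` (and `0 < ef`), for EVERY block size and ALL admissible letters (`B₀ > 0`; N06 `cC c137 kTJ k349 c137π k139π ≥ 0`; ★px6's column letters `ΘH ΘΔ G ≥ 0`),
# by EXPLICIT witnesses `ef α a₃ r ε′ εC C₄ M` (memo `NUMERICS-CENSUS-px14g3.md` ec96f60532af6d0e; v1 ✓p684622, composite ✓p684779)

Cell `ym3-torus`, width seat `ym3-torus-px14` (gen 3).  THEOREMS ONLY (0 `def`, 0 `sorry`); `--supports stmt-QuantumFields-19200 --as helper`; count-neutral.  YM₃ on T³ is a ladder rung (R3),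
NOT the Clay problem; nothing here claims the stub, the crux, d = 4 or the mass gap.  PURE REAL ARITHMETIC over ✓`Prop7NumericWindowsInhabited`'s row lemmas.

WHAT CHANGED SINCE THE COMPOSITE CENSUS (S15 → S16ᴰ): `Mρ := 1`, `Mτ := 2`, `CV := 2·(1024·2·(α + 1∕16) + 2·138)` written out (★px21 ✓p685119); the kernel-column constants are ★px6's
EXPRESSIONS `θE := 2·ΘH·G·ℓ`, `θE′ := 2·ΘΔ·G·ℓ`, `θ₃ := (2ℓ + 1)·ΘH·G∕a₃` (✓p684620; `ℓ = (1 − 4B₀C₂(εC + a₃))⁻¹`), so `hC4`'s first term reads `2·((2ℓ+1)·ΘH·G∕a₃)·α` — it is the ONE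
place where `α ≤ a₃` is needed (then `≤ 2(2ℓ+1)ΘH·G ≤ (114∕7)·ΘH·G`); and ONE new window `hqΘ : (εC + a₃)·ΘH·G ≤ 1∕2` (Neumann (70)–(73)), met by shrinking `a₃ = εC := ef∕(8000·(B₀+1)·(ΘH·G+1))`
(the v1 witnesses at the «regime letter» `bH′ := (B₀+1)(ΘH·G+1) − 1 ≥ B₀`, so every v1 row lemma applies verbatim and the `B₀`-rows follow by monotonicity in `B₀ ≤ bH′`).

WHAT IS PROVED (sorry-free, no definition).
* §1 `row_hwinC` (`4C₂B₀ε′² ≤ εC` ⟸ `hq47` + `ε′ ≤ εC`); `row_hC4_S16` — monotonicity of S16ᴰ's written-out `hC4` constant in `(α, C₂, ℓ)` with the `α ≤ a₃` absorption of `θ₃·α`; `row_hqΘ`; `contr_le_of_le` (`B₀ ≤ bH′` transport of `contr_le`).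
* §2 ★★★ `numericWindows_inhabited_family_S16` — `∃ ef α a₃ r ε′ εC C₄ M : ℕ → ℝ` with positivity and the NINETEEN rows in S16ᴰ's binder shapes VERBATIM + `hwinC` (TWENTY) (so the final knit discharges every
  numeric row of S16ᴰ∕S17ᴸ∕S18 by ONE `obtain`, whatever the N06∕column letters' suppliers deliver).  Scale hierarchy forced (memo §5(a)): `ef ~ 10⁻¹⁰L⁻³`,
  `a₃ = εC ~ 10⁻⁴·ef∕(B₀·ΘH·G)`, `C₄ ~ 10³·N₁∕ef + 10⁵ + 10·ΘH·G`, `r ~ min(a₃∕4, (16B₀C₄)⁻¹)`, `α ~ min(ef∕M, r∕4B₀, a₃, …) ~ 10⁻⁴·ef²∕(N₁B₀²(1+cC))`.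
HONEST SCOPE.  Arithmetic only; nothing about the letters' suppliers; the EX stub is not touched.

References: T. Bałaban, CMP **102** (1985) 277–309 [Balaban1985Variational] (Thm 1 p.279, (70)–(77) pp.289–290, Prop. 4 (97)–(98) pp.292–293, (118)–(121) p.295, (136)–(140) pp.298–299).
-/

set_option autoImplicit false

noncomputable section

namespace Summit.QuantumFields.YangMills.Theorems.Prop7NumericWindowsInhabited

/-! ## §1 Row lemmas for S16ᴰ's written-out letters -/

/-- `contr_le` transported down in the regime letter: `B₀ ≤ bH′` and `4·bH′·C₂·(εC + a₃) ≤ 18∕25` give the same for `B₀`. [cite: Balaban1985Variational, (121) p.295] -/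
theorem contr_le_of_le {ef C₂ B₀ bH a₃ : ℝ} (hef : 0 < ef) (hB₀ : 0 < B₀) (hbH : B₀ ≤ bH) (hC₂0 : 0 ≤ C₂) (hC₂ : C₂ ≤ 720 / ef)
    (ha₃ : a₃ = ef / (8000 * (bH + 1))) : 4 * B₀ * C₂ * (a₃ + a₃) ≤ 18 / 25 := by
  have hbH0 : 0 < bH := lt_of_lt_of_le hB₀ hbH
  have ha₃0 : 0 < a₃ := by rw [ha₃]; positivity
  calc 4 * B₀ * C₂ * (a₃ + a₃) ≤ 4 * bH * C₂ * (a₃ + a₃) := by gcongr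
    _ ≤ 18 / 25 := contr_le hef hbH0 hC₂ ha₃

/-- Row `hqΘ` (★px6's Neumann window, [Balaban1985Variational] (70)–(73)): `(εC + a₃)·ΘH·G ≤ 1∕2` at `εC = a₃ = ef∕(8000·(B₀+1)·(ΘH·G+1))`, `ef ≤ 1`.
[cite: Balaban1985Variational, (70)–(73) pp.289–290] -/
theorem row_hqΘ {ef B₀ ΘH G a₃ : ℝ} (hef : 0 < ef) (hef1 : ef ≤ 1) (hB₀ : 0 < B₀) (hΘH : 0 ≤ ΘH) (hG : 0 ≤ G)
    (ha₃ : a₃ = ef / (8000 * (((B₀ + 1) * (ΘH * G + 1) - 1) + 1))) : (a₃ + a₃) * ΘH * G ≤ 1 / 2 := by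
  have hx : 0 ≤ ΘH * G := mul_nonneg hΘH hG
  have hden : 0 < 8000 * (((B₀ + 1) * (ΘH * G + 1) - 1) + 1) := by nlinarith
  have h1 : a₃ * (ΘH * G + 1) ≤ ef / 8000 := by
    rw [ha₃, div_mul_eq_mul_div, div_le_div_iff₀ hden (by norm_num)]
    have : ef * (ΘH * G + 1) * 8000 ≤ ef * (8000 * ((B₀ + 1) * (ΘH * G + 1))) := by nlinarith [mul_nonneg hef.le hx]
    linarith [show (8000 : ℝ) * (((B₀ + 1) * (ΘH * G + 1) - 1) + 1) = 8000 * ((B₀ + 1) * (ΘH * G + 1)) by ring]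
  have ha₃0 : 0 ≤ a₃ := by rw [ha₃]; positivity
  nlinarith [mul_nonneg ha₃0 hx]

/-- Row `hwinC` (★px21 g4 ✓p687965 «HCHART-FAMILY-AT-RECORD», (G22)ᴾ's window: the pinv chart's correction on the `ηε′`-ball stays in lit's `εC`-ball): `4·C₂·B₀·ε′² ≤ εC` from `hq47`
(`9·C₂·B₀·ε′ < 1`) and `0 ≤ ε′ ≤ εC`. [cite: Balaban1985Variational, (47) p.285, Prop. 3 p.289] -/
theorem row_hwinC {C₂ B₀ ε' εC : ℝ} (hε'0 : 0 ≤ ε') (hε' : ε' ≤ εC) (hq47 : 9 * C₂ * B₀ * ε' < 1) :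
    4 * C₂ * B₀ * ε' ^ 2 ≤ εC := by
  have h1 : 4 * C₂ * B₀ * ε' ^ 2 = (4 / 9) * ((9 * C₂ * B₀ * ε') * ε') := by ring
  have h2 : (9 * C₂ * B₀ * ε') * ε' ≤ 1 * ε' := mul_le_mul_of_nonneg_right hq47.le hε'0
  rw [h1]
  linarith

/-- Row `hC4` of S16ᴰ (★px5's composite constant with ★px21's `Mρ = 1`, `Mτ = 2`, explicit `CV`, and ★px6's `θE θE′ θ₃` EXPRESSIONS) is MONOTONE in `(α, C₂, ℓ)` once `α ≤ a₃` absorbs the `θ₃·α` term: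
its LHS is below the same polynomial at the bars `α ↦ 1` (`θ₃·α ↦ (2·25∕7+1)·ΘH·G`), `C₂ ↦ 720∕ef`, `ℓ ↦ 25∕7`. [cite: Balaban1985Variational, Prop. 4 (97)–(98) pp.292–293, (73) p.289] -/
theorem row_hC4_S16 {ef C₂ B₀ bH a₃ α ΘH ΘΔ G N₁ : ℝ} (hef : 0 < ef) (hB₀ : 0 < B₀) (hbH : B₀ ≤ bH) (hC₂0 : 0 ≤ C₂) (hC₂ : C₂ ≤ 720 / ef)
    (ha₃ : a₃ = ef / (8000 * (bH + 1))) (hα0 : 0 ≤ α) (hα1 : α ≤ 1) (hαa : α ≤ a₃) (hΘH : 0 ≤ ΘH) (hΘΔ : 0 ≤ ΘΔ) (hG : 0 ≤ G) (hN₁ : 0 ≤ N₁) :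
    1 * 2 * ((2 * (1 / (1 - 4 * B₀ * C₂ * (a₃ + a₃))) + 1) * (ΘH * G) / a₃) * α
        + (N₁ * C₂ * (1 / (1 - 4 * B₀ * C₂ * (a₃ + a₃))) ^ 2 + 1 * 2 * (2 * ΘΔ * G * (1 / (1 - 4 * B₀ * C₂ * (a₃ + a₃)))))
        + 1 * 2 * (2 * ΘH * G * (1 / (1 - 4 * B₀ * C₂ * (a₃ + a₃)))) * (N₁ * C₂ * (1 / (1 - 4 * B₀ * C₂ * (a₃ + a₃))) ^ 2) * a₃
        + 1 * 2 * (1 + (2 * ΘH * G * (1 / (1 - 4 * B₀ * C₂ * (a₃ + a₃)))) * a₃) * (2 * (1024 * ((3 - 1 : ℕ) : ℝ) * 1 * (α + 1 / 16) + ((3 - 1 : ℕ) : ℝ) * 138 * 1))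
            * (1 / (1 - 4 * B₀ * C₂ * (a₃ + a₃))) ^ 2
      ≤ 1 * 2 * ((2 * (25 / 7) + 1) * (ΘH * G))
        + (N₁ * (720 / ef) * (25 / 7) ^ 2 + 1 * 2 * (2 * ΘΔ * G * (25 / 7)))
        + 1 * 2 * (2 * ΘH * G * (25 / 7)) * (N₁ * (720 / ef) * (25 / 7) ^ 2) * a₃
        + 1 * 2 * (1 + (2 * ΘH * G * (25 / 7)) * a₃) * (2 * (1024 * ((3 - 1 : ℕ) : ℝ) * 1 * (1 + 1 / 16) + ((3 - 1 : ℕ) : ℝ) * 138 * 1)) * (25 / 7) ^ 2 := by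
  have hbH0 : 0 < bH := lt_of_lt_of_le hB₀ hbH
  have ha₃0 : 0 < a₃ := by rw [ha₃]; positivity
  obtain ⟨hℓ, hℓ0⟩ := ell_le (contr_le_of_le hef hB₀ hbH hC₂0 hC₂ ha₃)
  have hx : 0 ≤ ΘH * G := mul_nonneg hΘH hG
  -- the `θ₃·α` term: `((2ℓ+1)·ΘH·G ∕ a₃)·α ≤ (2ℓ+1)·ΘH·G ≤ (2·25∕7+1)·ΘH·G`
  have h1 : (2 * (1 / (1 - 4 * B₀ * C₂ * (a₃ + a₃))) + 1) * (ΘH * G) / a₃ * α ≤ (2 * (25 / 7) + 1) * (ΘH * G) := by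
    rw [div_mul_eq_mul_div, div_le_iff₀ ha₃0]
    have h2 : (2 * (1 / (1 - 4 * B₀ * C₂ * (a₃ + a₃))) + 1) * (ΘH * G) * α ≤ (2 * (25 / 7) + 1) * (ΘH * G) * α := by gcongr
    have h3 : (2 * (25 / 7) + 1) * (ΘH * G) * α ≤ (2 * (25 / 7) + 1) * (ΘH * G) * a₃ :=
      mul_le_mul_of_nonneg_left hαa (by positivity)
    linarith
  have h1' : 1 * 2 * ((2 * (1 / (1 - 4 * B₀ * C₂ * (a₃ + a₃))) + 1) * (ΘH * G) / a₃) * α ≤ 1 * 2 * ((2 * (25 / 7) + 1) * (ΘH * G)) := by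
    have := mul_le_mul_of_nonneg_left h1 (by norm_num : (0 : ℝ) ≤ 1 * 2)
    linarith [show 1 * 2 * ((2 * (1 / (1 - 4 * B₀ * C₂ * (a₃ + a₃))) + 1) * (ΘH * G) / a₃) * α
      = 1 * 2 * ((2 * (1 / (1 - 4 * B₀ * C₂ * (a₃ + a₃))) + 1) * (ΘH * G) / a₃ * α) by ring]
  have hrest : (N₁ * C₂ * (1 / (1 - 4 * B₀ * C₂ * (a₃ + a₃))) ^ 2 + 1 * 2 * (2 * ΘΔ * G * (1 / (1 - 4 * B₀ * C₂ * (a₃ + a₃)))))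
        + 1 * 2 * (2 * ΘH * G * (1 / (1 - 4 * B₀ * C₂ * (a₃ + a₃)))) * (N₁ * C₂ * (1 / (1 - 4 * B₀ * C₂ * (a₃ + a₃))) ^ 2) * a₃
        + 1 * 2 * (1 + (2 * ΘH * G * (1 / (1 - 4 * B₀ * C₂ * (a₃ + a₃)))) * a₃) * (2 * (1024 * ((3 - 1 : ℕ) : ℝ) * 1 * (α + 1 / 16) + ((3 - 1 : ℕ) : ℝ) * 138 * 1))
            * (1 / (1 - 4 * B₀ * C₂ * (a₃ + a₃))) ^ 2
      ≤ (N₁ * (720 / ef) * (25 / 7) ^ 2 + 1 * 2 * (2 * ΘΔ * G * (25 / 7)))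
        + 1 * 2 * (2 * ΘH * G * (25 / 7)) * (N₁ * (720 / ef) * (25 / 7) ^ 2) * a₃
        + 1 * 2 * (1 + (2 * ΘH * G * (25 / 7)) * a₃) * (2 * (1024 * ((3 - 1 : ℕ) : ℝ) * 1 * (1 + 1 / 16) + ((3 - 1 : ℕ) : ℝ) * 138 * 1)) * (25 / 7) ^ 2 := by
    gcongr
  linarith

/-! ## §2 ★★★ The S16ᴰ census -/

set_option maxHeartbeats 400000 in
/-- ★★★ **«NUMERICS-CENSUS» v2 — THE NINETEEN L-ONLY NUMERIC ROWS OF THE EX DISPLAY OF RECORD S16ᴰ (✓p685936 :115–:240) ARE JOINTLY INHABITED, WITH ALL POSITIVITY BINDERS**, for every block size,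
every `B₀ > 0`, all nonnegative N06 letters `cC c137 kTJ k349 c137π k139π` and column letters `ΘH ΘΔ G`: there are `ef α a₃ r ε′ εC C₄ M : ℕ → ℝ` with `hef hα ha₃ hr hC₄ hM` and
`hWQ hWe hWε hMe hw137 hq47 hR6 hrε2 hεC hdomC hselfC hcontrC hrα hr4 hr16 hqΘ hR16 hC4 hMdoor` in S16ᴰ's binder shapes VERBATIM, plus S18's `hwinC` (★px21 ✓p687965: `4·C₂·B₀·ε′² ≤ εC`).  Witnesses: `ef := (356·10⁷·L³)⁻¹`,
`a₃ := εC := ef∕(8000·(B₀+1)·(ΘH·G+1))`, `C₄ :=` the `hC4` polynomial at the bars `+ 1`, `r := min(a₃∕4, (16B₀C₄)⁻¹)`, `M :=` the door polynomial at `(720∕ef, α₀ := ef∕(2700L))`,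
`α := ½·min(min(min(α₀, ef∕M), min(r∕(2B₀), (13·10¹⁴L³)⁻¹)), a₃)`, `ε′ := 2(r + 2B₀α)`.
[cite: Balaban1985Variational, Thm 1 p.279, (70)–(77) pp.289–290, Prop. 4 (97)–(98) pp.292–293, (118)–(121) p.295, (136)–(140) pp.298–299] -/
theorem numericWindows_inhabited_family_S16
    (B₀ cC c137 kTJ k349 c137π k139π ΘH ΘΔ G : ℕ → ℝ) (hB₀ : ∀ L, 1 < L → 0 < B₀ L)
    (hk : ∀ L : ℕ, 1 < L → 0 ≤ cC L ∧ 0 ≤ c137 L ∧ 0 ≤ kTJ L ∧ 0 ≤ k349 L ∧ 0 ≤ c137π L ∧ 0 ≤ k139π L)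
    (hΘH0 : ∀ L, 1 < L → 0 ≤ ΘH L) (hΘΔ0 : ∀ L, 1 < L → 0 ≤ ΘΔ L) (hG0 : ∀ L, 1 < L → 0 ≤ G L) :
    ∃ ef α a₃ r ε' εC C₄ M : ℕ → ℝ,
      (∀ L, 1 < L → 0 < ef L) ∧ (∀ L, 1 < L → 0 < α L) ∧ (∀ L, 1 < L → 0 < a₃ L) ∧ (∀ L, 1 < L → 0 < r L) ∧ (∀ L, 1 < L → 0 < C₄ L) ∧ (∀ L, 1 < L → 0 < M L) ∧
      -- hWQ hWe hWε hMe hw137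
      (∀ L : ℕ, 1 < L → 13 * 10 ^ 14 * (L : ℝ) ^ 3 * α L ≤ 1) ∧ (∀ L : ℕ, 1 < L → 10 ^ 9 * (L : ℝ) ^ 2 * ef L ≤ 1) ∧ (∀ L : ℕ, 1 < L → 10 ^ 12 * (L : ℝ) ^ 3 * α L ≤ 1) ∧
      (∀ L, 1 < L → M L * α L < ef L) ∧ (∀ L : ℕ, 1 < L → 10 ^ 7 * (L : ℝ) ^ 3 * (178 * (α L + ef L)) ≤ 1) ∧
      -- hq47 hR6 hrε2
      (∀ L : ℕ, 1 < L → 9 * (40 * (2 * (3 * (2 * ef L + 2700 * (L : ℝ) * α L))) / ef L ^ 2) * B₀ L * ε' L < 1) ∧ (∀ L : ℕ, 1 < L → 6 * ε' L ≤ ef L) ∧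
      (∀ L : ℕ, 1 < L → 2 * (r L + 2 * B₀ L * α L) ≤ ε' L) ∧
      -- hεC hdomC hselfC hcontrC (regime constant `B₀`, as in S14ᴰ–S16ᴰ)
      (∀ L : ℕ, 1 < L → 0 ≤ εC L) ∧ (∀ L : ℕ, 1 < L → 2 * (εC L + a₃ L) ≤ ef L / 2) ∧
      (∀ L : ℕ, 1 < L → B₀ L * (40 * (2 * (3 * (2 * ef L + 2700 * (L : ℝ) * α L))) / ef L ^ 2) * (εC L + a₃ L) ^ 2 ≤ εC L) ∧
      (∀ L : ℕ, 1 < L → 4 * B₀ L * (40 * (2 * (3 * (2 * ef L + 2700 * (L : ℝ) * α L))) / ef L ^ 2) * (εC L + a₃ L) < 1) ∧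
      -- hrα hr4 hr16
      (∀ L : ℕ, 1 < L → 2 * B₀ L * α L ≤ r L) ∧ (∀ L : ℕ, 1 < L → 4 * r L ≤ a₃ L) ∧ (∀ L : ℕ, 1 < L → 16 * B₀ L * C₄ L * r L ≤ 1) ∧
      -- hqΘ hR16 hC4
      (∀ L, 1 < L → (εC L + a₃ L) * ΘH L * G L ≤ 1 / 2) ∧
      (∀ L, 1 < L → a₃ L ≤ (1 - 4 * B₀ L * (40 * (2 * (3 * (2 * ef L + 2700 * (L : ℝ) * α L))) / ef L ^ 2) * (εC L + a₃ L)) * (1 / 16)) ∧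
      (∀ L, 1 < L → 1 * 2 * ((2 * (1 / (1 - 4 * B₀ L * (40 * (2 * (3 * (2 * ef L + 2700 * (L : ℝ) * α L))) / ef L ^ 2) * (εC L + a₃ L))) + 1) * (ΘH L * G L) / a₃ L) * α L + ((c137π L + k139π L * B₀ L) * (40 * (2 * (3 * (2 * ef L + 2700 * (L : ℝ) * α L))) / ef L ^ 2) * (1 / (1 - 4 * B₀ L * (40 * (2 * (3 * (2 * ef L + 2700 * (L : ℝ) * α L))) / ef L ^ 2) * (εC L + a₃ L))) ^ 2 + 1 * 2 * (2 * ΘΔ L * G L * (1 / (1 - 4 * B₀ L * (40 * (2 * (3 * (2 * ef L + 2700 * (L : ℝ) * α L))) / ef L ^ 2) * (εC L + a₃ L)))))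
            + 1 * 2 * (2 * ΘH L * G L * (1 / (1 - 4 * B₀ L * (40 * (2 * (3 * (2 * ef L + 2700 * (L : ℝ) * α L))) / ef L ^ 2) * (εC L + a₃ L)))) * ((c137π L + k139π L * B₀ L) * (40 * (2 * (3 * (2 * ef L + 2700 * (L : ℝ) * α L))) / ef L ^ 2) * (1 / (1 - 4 * B₀ L * (40 * (2 * (3 * (2 * ef L + 2700 * (L : ℝ) * α L))) / ef L ^ 2) * (εC L + a₃ L))) ^ 2) * a₃ L
            + 1 * 2 * (1 + (2 * ΘH L * G L * (1 / (1 - 4 * B₀ L * (40 * (2 * (3 * (2 * ef L + 2700 * (L : ℝ) * α L))) / ef L ^ 2) * (εC L + a₃ L)))) * a₃ L) * (2 * (1024 * ((3 - 1 : ℕ) : ℝ) * 1 * (α L + 1 / 16) + ((3 - 1 : ℕ) : ℝ) * 138 * 1)) * (1 / (1 - 4 * B₀ L * (40 * (2 * (3 * (2 * ef L + 2700 * (L : ℝ) * α L))) / ef L ^ 2) * (εC L + a₃ L))) ^ 2 ≤ C₄ L) ∧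
      -- hwinC (★px21 ✓p687965, S18∕S19)
      (∀ L, 1 < L → 4 * (40 * (2 * (3 * (2 * ef L + 2700 * (L : ℝ) * α L))) / ef L ^ 2) * B₀ L * ε' L ^ 2 ≤ εC L) ∧
      -- hMdoor
      (∀ L : ℕ, 1 < L → 11 * B₀ L + 4 * B₀ L * (40 * (2 * (3 * (2 * ef L + 2700 * (L : ℝ) * α L))) / ef L ^ 2) * (11 * B₀ L) ^ 2 * α L + ((1 + 25 * C₄ L * B₀ L ^ 2) + cC L * (1 + 25 * C₄ L * B₀ L ^ 2) + c137 L * 2 + kTJ L * (10 * B₀ L) / 2 + 14 * (10 * B₀ L) + k349 L * (10 * B₀ L) / 2 + 2 * (10 * B₀ L)) + 100 * (c137π L + k139π L * B₀ L + k349 L * B₀ L + (28 + 4) * α L * B₀ L) * (40 * (2 * (3 * (2 * ef L + 2700 * (L : ℝ) * α L))) / ef L ^ 2) * B₀ L ^ 2 * α L ≤ M L) := by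
  classical
  -- the witnesses
  let ef : ℕ → ℝ := fun L => 1 / (356 * 10 ^ 7 * (L : ℝ) ^ 3)
  let α₀ : ℕ → ℝ := fun L => ef L / (2700 * (L : ℝ))
  let bH : ℕ → ℝ := fun L => (B₀ L + 1) * (ΘH L * G L + 1) - 1
  let a₃ : ℕ → ℝ := fun L => ef L / (8000 * (bH L + 1))
  obtain ⟨C₄, hC₄eq⟩ : ∃ C₄ : ℕ → ℝ, ∀ L, C₄ L = 1 * 2 * ((2 * (25 / 7) + 1) * (ΘH L * G L))
        + ((c137π L + k139π L * B₀ L) * (720 / ef L) * (25 / 7) ^ 2 + 1 * 2 * (2 * ΘΔ L * G L * (25 / 7)))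
        + 1 * 2 * (2 * ΘH L * G L * (25 / 7)) * ((c137π L + k139π L * B₀ L) * (720 / ef L) * (25 / 7) ^ 2) * a₃ L
        + 1 * 2 * (1 + (2 * ΘH L * G L * (25 / 7)) * a₃ L) * (2 * (1024 * ((3 - 1 : ℕ) : ℝ) * 1 * (1 + 1 / 16) + ((3 - 1 : ℕ) : ℝ) * 138 * 1)) * (25 / 7) ^ 2 + 1 :=
    ⟨_, fun L => rfl⟩
  let r : ℕ → ℝ := fun L => min (a₃ L / 4) (1 / (16 * B₀ L * C₄ L))
  obtain ⟨M, hMeq⟩ : ∃ M : ℕ → ℝ, ∀ L, M L = 11 * B₀ L + 4 * B₀ L * (720 / ef L) * (11 * B₀ L) ^ 2 * α₀ L + ((1 + 25 * C₄ L * B₀ L ^ 2) + cC L * (1 + 25 * C₄ L * B₀ L ^ 2)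
      + c137 L * 2 + kTJ L * (10 * B₀ L) / 2 + 14 * (10 * B₀ L) + k349 L * (10 * B₀ L) / 2 + 2 * (10 * B₀ L))
      + 100 * (c137π L + k139π L * B₀ L + k349 L * B₀ L + (28 + 4) * α₀ L * B₀ L) * (720 / ef L) * B₀ L ^ 2 * α₀ L := ⟨_, fun L => rfl⟩
  let α : ℕ → ℝ := fun L => (1 / 2) * min (min (min (α₀ L) (ef L / M L)) (min (r L / (2 * B₀ L)) (1 / (13 * 10 ^ 14 * (L : ℝ) ^ 3)))) (a₃ L)
  let ε' : ℕ → ℝ := fun L => 2 * (r L + 2 * B₀ L * α L)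
  -- positivity of the witnesses and the elementary comparisons, at each `L > 1`
  have hLr : ∀ L : ℕ, 1 < L → (1 : ℝ) ≤ (L : ℝ) := fun L hL => by exact_mod_cast hL.le
  have hef : ∀ L : ℕ, 1 < L → 0 < ef L := fun L hL => by
    have := hLr L hL; simp only [ef]; positivity
  have hx : ∀ L : ℕ, 1 < L → 0 ≤ ΘH L * G L := fun L hL => mul_nonneg (hΘH0 L hL) (hG0 L hL)
  have hbHge : ∀ L : ℕ, 1 < L → B₀ L ≤ bH L := fun L hL => by
    have := hx L hL; have := hB₀ L hL; simp only [bH]; nlinarith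
  have hbH0 : ∀ L : ℕ, 1 < L → 0 < bH L := fun L hL => lt_of_lt_of_le (hB₀ L hL) (hbHge L hL)
  have hbH1 : ∀ L : ℕ, 1 < L → 0 < bH L + 1 := fun L hL => by linarith [hbH0 L hL]
  have ha₃ : ∀ L : ℕ, 1 < L → 0 < a₃ L := fun L hL => by
    have := hef L hL; have := hbH1 L hL; simp only [a₃]; positivity
  have hα₀ : ∀ L : ℕ, 1 < L → 0 < α₀ L := fun L hL => by
    have := hef L hL; have := hLr L hL; simp only [α₀]; positivity
  have hC₄ : ∀ L : ℕ, 1 < L → 0 < C₄ L := fun L hL => by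
    obtain ⟨-, -, -, -, h5, h6⟩ := hk L hL
    have := hef L hL; have := ha₃ L hL; have := hx L hL; have := hΘΔ0 L hL; have := hG0 L hL; have := hΘH0 L hL; have := hB₀ L hL
    rw [hC₄eq]; positivity
  have hr : ∀ L : ℕ, 1 < L → 0 < r L := fun L hL => by
    have := ha₃ L hL; have := hB₀ L hL; have := hC₄ L hL
    simp only [r]; exact lt_min (by positivity) (by positivity)
  have hM : ∀ L : ℕ, 1 < L → 0 < M L := fun L hL => by
    obtain ⟨h1, h2, h3, h4, h5, h6⟩ := hk L hL
    have := hef L hL; have := hB₀ L hL; have := hC₄ L hL; have := hα₀ L hL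
    rw [hMeq]; positivity
  have hα : ∀ L : ℕ, 1 < L → 0 < α L := fun L hL => by
    have := hef L hL; have := hM L hL; have := hr L hL; have := hB₀ L hL; have := hα₀ L hL; have := hLr L hL; have := ha₃ L hL
    simp only [α]
    refine mul_pos (by norm_num) (lt_min (lt_min (lt_min ‹0 < α₀ L› (by positivity)) (lt_min (by positivity) (by positivity))) ‹0 < a₃ L›)
  -- the five caps on `α`
  have hmin : ∀ L : ℕ, 1 < L → ∀ t : ℝ,
      min (min (min (α₀ L) (ef L / M L)) (min (r L / (2 * B₀ L)) (1 / (13 * 10 ^ 14 * (L : ℝ) ^ 3)))) (a₃ L) ≤ t → α L ≤ t / 2 := fun L hL t ht => by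
    simp only [α]; linarith
  have hα_le₀ : ∀ L : ℕ, 1 < L → α L ≤ α₀ L / 2 := fun L hL =>
    hmin L hL _ (((min_le_left _ _).trans (min_le_left _ _)).trans (min_le_left _ _))
  have hα_leM : ∀ L : ℕ, 1 < L → α L ≤ (ef L / M L) / 2 := fun L hL =>
    hmin L hL _ (((min_le_left _ _).trans (min_le_left _ _)).trans (min_le_right _ _))
  have hα_ler : ∀ L : ℕ, 1 < L → α L ≤ (r L / (2 * B₀ L)) / 2 := fun L hL =>
    hmin L hL _ (((min_le_left _ _).trans (min_le_right _ _)).trans (min_le_left _ _))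
  have hα_leQ : ∀ L : ℕ, 1 < L → α L ≤ (1 / (13 * 10 ^ 14 * (L : ℝ) ^ 3)) / 2 := fun L hL =>
    hmin L hL _ (((min_le_left _ _).trans (min_le_right _ _)).trans (min_le_right _ _))
  have hα_lea : ∀ L : ℕ, 1 < L → α L ≤ a₃ L / 2 := fun L hL => hmin L hL _ (min_le_right _ _)
  -- derived comparisons
  have hα_le_α₀ : ∀ L : ℕ, 1 < L → α L ≤ α₀ L := fun L hL => by linarith [hα_le₀ L hL, hα₀ L hL]
  have hα_le_a₃ : ∀ L : ℕ, 1 < L → α L ≤ a₃ L := fun L hL => by linarith [hα_lea L hL, ha₃ L hL]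
  have h2700 : ∀ L : ℕ, 1 < L → 2700 * (L : ℝ) * α L ≤ ef L := fun L hL => by
    have hL0 : (0 : ℝ) < L := by linarith [hLr L hL]
    have h := hα_le_α₀ L hL
    simp only [α₀] at h
    rw [le_div_iff₀ (by positivity)] at h
    linarith
  have hC₂ : ∀ L : ℕ, 1 < L → 40 * (2 * (3 * (2 * ef L + 2700 * (L : ℝ) * α L))) / ef L ^ 2 ≤ 720 / ef L := fun L hL =>
    C₂_le (hef L hL) (h2700 L hL)
  have hC₂0 : ∀ L : ℕ, 1 < L → 0 ≤ 40 * (2 * (3 * (2 * ef L + 2700 * (L : ℝ) * α L))) / ef L ^ 2 := fun L hL =>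
    C₂_nonneg (hef L hL) (by linarith [hLr L hL]) (hα L hL).le
  have hα_le_ef : ∀ L : ℕ, 1 < L → α L ≤ ef L := fun L hL => by
    have h := h2700 L hL
    have hL1 := hLr L hL
    nlinarith [hα L hL]
  have hef_le_one : ∀ L : ℕ, 1 < L → ef L ≤ 1 := fun L hL => by
    have hL1 := hLr L hL
    have hL0 : (0 : ℝ) < L := by linarith
    simp only [ef]
    rw [div_le_one (by positivity)]
    nlinarith [one_le_pow₀ (n := 3) hL1]
  have hα_le_one : ∀ L : ℕ, 1 < L → α L ≤ 1 := fun L hL => (hα_le_ef L hL).trans (hef_le_one L hL)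
  have hr_le_a₃ : ∀ L : ℕ, 1 < L → r L ≤ a₃ L / 4 := fun L hL => min_le_left _ _
  have hr_le_C₄ : ∀ L : ℕ, 1 < L → r L ≤ 1 / (16 * B₀ L * C₄ L) := fun L hL => min_le_right _ _
  have h2B₀α : ∀ L : ℕ, 1 < L → 2 * B₀ L * α L ≤ r L / 2 := fun L hL => by
    have h := hα_ler L hL
    have hB := hB₀ L hL
    rw [div_div, le_div_iff₀ (by positivity)] at h
    linarith
  have hε'_le : ∀ L : ℕ, 1 < L → ε' L ≤ a₃ L := fun L hL => by
    simp only [ε']; linarith [h2B₀α L hL, hr_le_a₃ L hL, (ha₃ L hL).le]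
  have hε'0 : ∀ L : ℕ, 1 < L → 0 ≤ ε' L := fun L hL => by
    have := hr L hL; have := hB₀ L hL; have := hα L hL; simp only [ε']; positivity
  have ha₃def : ∀ L : ℕ, a₃ L = ef L / (8000 * (bH L + 1)) := fun L => rfl
  -- the B₀-rows from the bH′-rows by monotonicity (`B₀ ≤ bH′`)
  have hself : ∀ L : ℕ, 1 < L → B₀ L * (40 * (2 * (3 * (2 * ef L + 2700 * (L : ℝ) * α L))) / ef L ^ 2) * (a₃ L + a₃ L) ^ 2 ≤ a₃ L := fun L hL => by
    have h := row_hselfC (hef L hL) (hbH0 L hL) (hC₂ L hL) (ha₃def L)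
    have hB := hB₀ L hL; have hC := hC₂0 L hL
    calc B₀ L * (40 * (2 * (3 * (2 * ef L + 2700 * (L : ℝ) * α L))) / ef L ^ 2) * (a₃ L + a₃ L) ^ 2
        ≤ bH L * (40 * (2 * (3 * (2 * ef L + 2700 * (L : ℝ) * α L))) / ef L ^ 2) * (a₃ L + a₃ L) ^ 2 := by gcongr; exact hbHge L hL
      _ ≤ a₃ L := h
  have hcontr : ∀ L : ℕ, 1 < L → 4 * B₀ L * (40 * (2 * (3 * (2 * ef L + 2700 * (L : ℝ) * α L))) / ef L ^ 2) * (a₃ L + a₃ L) < 1 := fun L hL => by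
    have h := row_hcontrC (hef L hL) (hbH0 L hL) (hC₂ L hL) (ha₃def L)
    have hB := hB₀ L hL; have hC := hC₂0 L hL; have ha := ha₃ L hL
    calc 4 * B₀ L * (40 * (2 * (3 * (2 * ef L + 2700 * (L : ℝ) * α L))) / ef L ^ 2) * (a₃ L + a₃ L)
        ≤ 4 * bH L * (40 * (2 * (3 * (2 * ef L + 2700 * (L : ℝ) * α L))) / ef L ^ 2) * (a₃ L + a₃ L) := by gcongr; exact hbHge L hL
      _ < 1 := h
  refine ⟨ef, α, a₃, r, ε', a₃, C₄, M, hef, hα, ha₃, hr, hC₄, hM, ?_, ?_, ?_, ?_, ?_, ?_, ?_, ?_, ?_, ?_, ?_, ?_, ?_, ?_, ?_, ?_, ?_, ?_, ?_, ?_⟩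
  -- hWQ
  · intro L hL
    have h := hα_leQ L hL
    have hL0 : (0 : ℝ) < L := by linarith [hLr L hL]
    rw [div_div, le_div_iff₀ (by positivity)] at h
    linarith
  -- hWe
  · intro L hL
    exact row_hWe (hLr L hL)
  -- hWε
  · intro L hL
    have h := hα_leQ L hL
    have hL0 : (0 : ℝ) < L := by linarith [hLr L hL]
    rw [div_div, le_div_iff₀ (by positivity)] at h
    nlinarith [hα L hL, pow_pos hL0 3]
  -- hMe
  · intro L hL
    have h := hα_leM L hL
    have hM' := hM L hL
    rw [div_div, le_div_iff₀ (by positivity)] at h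
    nlinarith [hef L hL]
  -- hw137
  · intro L hL
    have hL0 : (0 : ℝ) < L := by linarith [hLr L hL]
    exact row_hw137 hL0 (hα_le_ef L hL)
  -- hq47 (at the regime letter bH′ ≥ B₀)
  · intro L hL
    exact row_hq47 (hef L hL) (hB₀ L hL) (hbHge L hL) (hC₂ L hL) (hε'0 L hL) (hε'_le L hL) (ha₃def L)
  -- hR6
  · intro L hL
    exact row_hR6 (hef L hL) (hbH0 L hL) (hε'_le L hL) (ha₃def L)
  -- hrε2
  · intro L hL
    exact le_rfl
  -- hεC
  · intro L hL
    exact (ha₃ L hL).le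
  -- hdomC
  · intro L hL
    exact row_hdomC (hef L hL) (hbH0 L hL) (ha₃def L)
  -- hselfC
  · intro L hL
    exact hself L hL
  -- hcontrC
  · intro L hL
    exact hcontr L hL
  -- hrα
  · intro L hL
    linarith [h2B₀α L hL, hr L hL]
  -- hr4
  · intro L hL
    linarith [hr_le_a₃ L hL]
  -- hr16
  · intro L hL
    have h := hr_le_C₄ L hL
    have := hB₀ L hL; have := hC₄ L hL
    rw [le_div_iff₀ (by positivity)] at h
    linarith
  -- hqΘ
  · intro L hL
    exact row_hqΘ (hef L hL) (hef_le_one L hL) (hB₀ L hL) (hΘH0 L hL) (hG0 L hL) (rfl : a₃ L = ef L / (8000 * (((B₀ L + 1) * (ΘH L * G L + 1) - 1) + 1)))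
  -- hR16
  · intro L hL
    have h := row_hR16 (hLr L hL) (rfl : ef L = 1 / (356 * 10 ^ 7 * (L : ℝ) ^ 3)) (hbH0 L hL) (hC₂ L hL) (ha₃def L)
    -- `(1 − 4bH′C₂(2a₃))∕16 ≤ (1 − 4B₀C₂(2a₃))∕16`
    have hmono : (1 - 4 * bH L * (40 * (2 * (3 * (2 * ef L + 2700 * (L : ℝ) * α L))) / ef L ^ 2) * (a₃ L + a₃ L)) * (1 / 16)
        ≤ (1 - 4 * B₀ L * (40 * (2 * (3 * (2 * ef L + 2700 * (L : ℝ) * α L))) / ef L ^ 2) * (a₃ L + a₃ L)) * (1 / 16) := by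
      have hC := hC₂0 L hL; have ha := (ha₃ L hL).le; have hb := hbHge L hL
      have h4 : 4 * B₀ L * (40 * (2 * (3 * (2 * ef L + 2700 * (L : ℝ) * α L))) / ef L ^ 2) * (a₃ L + a₃ L)
          ≤ 4 * bH L * (40 * (2 * (3 * (2 * ef L + 2700 * (L : ℝ) * α L))) / ef L ^ 2) * (a₃ L + a₃ L) := by
        have hB := (hB₀ L hL).le; gcongr
      exact mul_le_mul_of_nonneg_right (sub_le_sub_left h4 1) (by norm_num)
    exact h.trans hmono
  -- hC4
  · intro L hL
    obtain ⟨-, -, -, -, h5, h6⟩ := hk L hL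
    have hN₁ : 0 ≤ c137π L + k139π L * B₀ L := by have := hB₀ L hL; positivity
    have h := row_hC4_S16 (hef L hL) (hB₀ L hL) (hbHge L hL) (hC₂0 L hL) (hC₂ L hL) (ha₃def L) (hα L hL).le (hα_le_one L hL) (hα_le_a₃ L hL)
      (hΘH0 L hL) (hΘΔ0 L hL) (hG0 L hL) hN₁
    rw [hC₄eq]
    exact h.trans (le_add_of_nonneg_right zero_le_one)
  -- hwinC
  · intro L hL
    exact row_hwinC (hε'0 L hL) (hε'_le L hL)
      (row_hq47 (hef L hL) (hB₀ L hL) (hbHge L hL) (hC₂ L hL) (hε'0 L hL) (hε'_le L hL) (ha₃def L))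
  -- hMdoor
  · intro L hL
    obtain ⟨-, -, -, h4, h5, h6⟩ := hk L hL
    rw [hMeq]
    exact row_hMdoor (hef L hL) (hB₀ L hL) (hα L hL).le (hα_le_α₀ L hL) (hC₂0 L hL) (hC₂ L hL) h4 h5 h6

/-! ## §3 ★★ The census read at S20ᴸ∕S21ᴸ's letters (`G := 6·g`) -/

set_option maxHeartbeats 400000 in
/-- ★★ **«NUMERICS-CENSUS» v2.1 — THE SAME CERTIFICATE READ AT S20ᴸ∕S21ᴸ's LETTERS (EX namer ★w2-19200 g7 2026-08-29T02:27:32Z «from S20ᴸ on read `G := 6·g` in `hqΘ hC4`»; S21ᴸ ✓p690389 =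
the display of record-to-be, `hwinC` gone):** letters `(… ΘH ΘΔ g)` with `hg0 : 0 ≤ g L` (★px18's (157) entry constant), rows `hqΘ hC4` with `(6 * g L)` in place of `G L` — S21ᴸ's binder texts
VERBATIM — and the other seventeen numerals + positivity unchanged; proof = v2 at `G := fun L ↦ 6·g L` (β) with the spare `hwinC` conjunct dropped.
[cite: Balaban1985Variational, Thm 1 p.279, (70)–(77) pp.289–290, Prop. 4 (97)–(98) pp.292–293, (118)–(121) p.295, (136)–(140) pp.298–299; Balaban1985Averaging, Prop. 5 (157) p.42] -/
theorem numericWindows_inhabited_family_S20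
    (B₀ cC c137 kTJ k349 c137π k139π ΘH ΘΔ g : ℕ → ℝ) (hB₀ : ∀ L, 1 < L → 0 < B₀ L)
    (hk : ∀ L : ℕ, 1 < L → 0 ≤ cC L ∧ 0 ≤ c137 L ∧ 0 ≤ kTJ L ∧ 0 ≤ k349 L ∧ 0 ≤ c137π L ∧ 0 ≤ k139π L)
    (hΘH0 : ∀ L, 1 < L → 0 ≤ ΘH L) (hΘΔ0 : ∀ L, 1 < L → 0 ≤ ΘΔ L) (hg0 : ∀ L : ℕ, 1 < L → 0 ≤ g L) :
    ∃ ef α a₃ r ε' εC C₄ M : ℕ → ℝ,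
      (∀ L, 1 < L → 0 < ef L) ∧ (∀ L, 1 < L → 0 < α L) ∧ (∀ L, 1 < L → 0 < a₃ L) ∧ (∀ L, 1 < L → 0 < r L) ∧ (∀ L, 1 < L → 0 < C₄ L) ∧ (∀ L, 1 < L → 0 < M L) ∧
      -- hWQ hWe hWε hMe hw137
      (∀ L : ℕ, 1 < L → 13 * 10 ^ 14 * (L : ℝ) ^ 3 * α L ≤ 1) ∧ (∀ L : ℕ, 1 < L → 10 ^ 9 * (L : ℝ) ^ 2 * ef L ≤ 1) ∧ (∀ L : ℕ, 1 < L → 10 ^ 12 * (L : ℝ) ^ 3 * α L ≤ 1) ∧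
      (∀ L, 1 < L → M L * α L < ef L) ∧ (∀ L : ℕ, 1 < L → 10 ^ 7 * (L : ℝ) ^ 3 * (178 * (α L + ef L)) ≤ 1) ∧
      -- hq47 hR6 hrε2
      (∀ L : ℕ, 1 < L → 9 * (40 * (2 * (3 * (2 * ef L + 2700 * (L : ℝ) * α L))) / ef L ^ 2) * B₀ L * ε' L < 1) ∧ (∀ L : ℕ, 1 < L → 6 * ε' L ≤ ef L) ∧
      (∀ L : ℕ, 1 < L → 2 * (r L + 2 * B₀ L * α L) ≤ ε' L) ∧
      -- hεC hdomC hselfC hcontrC (regime constant `B₀`, as in S14ᴰ–S16ᴰ)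
      (∀ L : ℕ, 1 < L → 0 ≤ εC L) ∧ (∀ L : ℕ, 1 < L → 2 * (εC L + a₃ L) ≤ ef L / 2) ∧
      (∀ L : ℕ, 1 < L → B₀ L * (40 * (2 * (3 * (2 * ef L + 2700 * (L : ℝ) * α L))) / ef L ^ 2) * (εC L + a₃ L) ^ 2 ≤ εC L) ∧
      (∀ L : ℕ, 1 < L → 4 * B₀ L * (40 * (2 * (3 * (2 * ef L + 2700 * (L : ℝ) * α L))) / ef L ^ 2) * (εC L + a₃ L) < 1) ∧
      -- hrα hr4 hr16
      (∀ L : ℕ, 1 < L → 2 * B₀ L * α L ≤ r L) ∧ (∀ L : ℕ, 1 < L → 4 * r L ≤ a₃ L) ∧ (∀ L : ℕ, 1 < L → 16 * B₀ L * C₄ L * r L ≤ 1) ∧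
      -- hqΘ hR16 hC4
      (∀ L, 1 < L → (εC L + a₃ L) * ΘH L * (6 * g L) ≤ 1 / 2) ∧
      (∀ L, 1 < L → a₃ L ≤ (1 - 4 * B₀ L * (40 * (2 * (3 * (2 * ef L + 2700 * (L : ℝ) * α L))) / ef L ^ 2) * (εC L + a₃ L)) * (1 / 16)) ∧
      (∀ L, 1 < L → 1 * 2 * ((2 * (1 / (1 - 4 * B₀ L * (40 * (2 * (3 * (2 * ef L + 2700 * (L : ℝ) * α L))) / ef L ^ 2) * (εC L + a₃ L))) + 1) * (ΘH L * (6 * g L)) / a₃ L) * α L + ((c137π L + k139π L * B₀ L) * (40 * (2 * (3 * (2 * ef L + 2700 * (L : ℝ) * α L))) / ef L ^ 2) * (1 / (1 - 4 * B₀ L * (40 * (2 * (3 * (2 * ef L + 2700 * (L : ℝ) * α L))) / ef L ^ 2) * (εC L + a₃ L))) ^ 2 + 1 * 2 * (2 * ΘΔ L * (6 * g L) * (1 / (1 - 4 * B₀ L * (40 * (2 * (3 * (2 * ef L + 2700 * (L : ℝ) * α L))) / ef L ^ 2) * (εC L + a₃ L)))))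
            + 1 * 2 * (2 * ΘH L * (6 * g L) * (1 / (1 - 4 * B₀ L * (40 * (2 * (3 * (2 * ef L + 2700 * (L : ℝ) * α L))) / ef L ^ 2) * (εC L + a₃ L)))) * ((c137π L + k139π L * B₀ L) * (40 * (2 * (3 * (2 * ef L + 2700 * (L : ℝ) * α L))) / ef L ^ 2) * (1 / (1 - 4 * B₀ L * (40 * (2 * (3 * (2 * ef L + 2700 * (L : ℝ) * α L))) / ef L ^ 2) * (εC L + a₃ L))) ^ 2) * a₃ L
            + 1 * 2 * (1 + (2 * ΘH L * (6 * g L) * (1 / (1 - 4 * B₀ L * (40 * (2 * (3 * (2 * ef L + 2700 * (L : ℝ) * α L))) / ef L ^ 2) * (εC L + a₃ L)))) * a₃ L) * (2 * (1024 * ((3 - 1 : ℕ) : ℝ) * 1 * (α L + 1 / 16) + ((3 - 1 : ℕ) : ℝ) * 138 * 1)) * (1 / (1 - 4 * B₀ L * (40 * (2 * (3 * (2 * ef L + 2700 * (L : ℝ) * α L))) / ef L ^ 2) * (εC L + a₃ L))) ^ 2 ≤ C₄ L) ∧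
      -- hMdoor
      (∀ L : ℕ, 1 < L → 11 * B₀ L + 4 * B₀ L * (40 * (2 * (3 * (2 * ef L + 2700 * (L : ℝ) * α L))) / ef L ^ 2) * (11 * B₀ L) ^ 2 * α L + ((1 + 25 * C₄ L * B₀ L ^ 2) + cC L * (1 + 25 * C₄ L * B₀ L ^ 2) + c137 L * 2 + kTJ L * (10 * B₀ L) / 2 + 14 * (10 * B₀ L) + k349 L * (10 * B₀ L) / 2 + 2 * (10 * B₀ L)) + 100 * (c137π L + k139π L * B₀ L + k349 L * B₀ L + (28 + 4) * α L * B₀ L) * (40 * (2 * (3 * (2 * ef L + 2700 * (L : ℝ) * α L))) / ef L ^ 2) * B₀ L ^ 2 * α L ≤ M L) := by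
  obtain ⟨ef, α, a₃, r, ε', εC, C₄, M, hef, hα, ha₃, hr, hC₄, hM, hWQ, hWe, hWε, hMe, hw137, hq47, hR6, hrε2, hεC, hdomC, hselfC, hcontrC,
      hrα, hr4, hr16, hqΘ, hR16, hC4, -, hMdoor⟩ :=
    numericWindows_inhabited_family_S16 B₀ cC c137 kTJ k349 c137π k139π ΘH ΘΔ (fun L => 6 * g L) hB₀ hk hΘH0 hΘΔ0
      (fun L hL => mul_nonneg (by norm_num) (hg0 L hL))
  exact ⟨ef, α, a₃, r, ε', εC, C₄, M, hef, hα, ha₃, hr, hC₄, hM, hWQ, hWe, hWε, hMe, hw137, hq47, hR6, hrε2, hεC, hdomC, hselfC, hcontrC,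
    hrα, hr4, hr16, hqΘ, hR16, hC4, hMdoor⟩

end Summit.QuantumFields.YangMills.Theorems.Prop7NumericWindowsInhabited

end
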